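import Literature.NumberTheory.Sieve.MoebiusShiftedPrimesSieveBound
import HarnessLib

/-!
# The upper-bound sieve for a pair of linear forms, uniform in the coefficients

Topic `Literature/NumberTheory/Sieve`.  For linear forms `ℓ₁(k) = α₁k + β₁`, `ℓ₂(k) = α₂k + β₂`
(`α₁, α₂ ≥ 1`, `(α₁, β₁) = 1`, `Δ = |α₁β₂ − α₂β₁| ≠ 0`) and sieving levels `2 ≤ w₁, w₂ ≤ K`, this file
PROVES the classical two-dimensional sieve upper bound

  `#{k ≤ K : p ∣ ℓ₁(k) ⇒ p ≥ w₁, and p ∣ ℓ₂(k) ⇒ (p ≥ w₂ or p ∣ α₂Δ)} ≤ C · (α₁/φ(α₁)) · (α₂Δ/φ(α₂Δ)) · K/(log w₁ log w₂)`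

with an ABSOLUTE constant `C` (`PairLinearSieve.card_sifted_le`).  With `ℓ₁(k) = k`, `ℓ₂(k) = mk + h`
(`Δ = h`) this is the case `m₁ = m₂ = 0` of Matomäki–Merikoski's Lemma 3.1(i) (IMRN 2023,
arXiv:2112.11412, p. 8: "`∑_{n ≤ X} 1_{(n,P(w₁))=1} 1_{(±n+h,P_h(w₂))=1} ≪ (h/φ(h)) (X/log²X)(log X/log w₁)(log X/log w₂)`",
there for `m = 1` and quoted from Henriot's Nair–Tenenbaum bound), for a general linear form in place
of `±n + h`; it is also the sieve input (Lemma 6 of Henriot 2012 for two linear forms, trivial prime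
power conditions) of any Nair–Tenenbaum-type bound for such pairs.

## Proof

The tree's upper-bound beta sieve of dimension `κ` (`SieveSequence.sifted_le_of_dvd_primesProdBelow`,
`SieveFrameworkUpperBound.lean`) applied, exactly as in `MoebiusShiftedPrimesSieveBound.lean` (whose
Chinese-remainder count, Mertens products and Chebyshev-free bookkeeping are reused), to the values
`Φ(k) = ∏_{p<w₁, p∤α₁, p∣ℓ₁(k)} p · ∏_{p<w₂, p∤α₂Δ, p∣ℓ₂(k)} p`: a prime `q` divides `Φ(k)` iff `k` lies
in a removed class modulo `q` — the root of `ℓ₁ ≡ 0` (`q < w₁`, `q ∤ α₁`) or the root of `ℓ₂ ≡ 0`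
(`q < w₂`, `q ∤ α₂Δ`); the two roots are distinct modulo `q ∤ Δ`, so the density is `ω(q)/q` with
`ω(q) = [q<w₁, q∤α₁] + [q<w₂, q∤α₂Δ] ≤ 2`, `ω(2) ≤ 1` outside the degenerate case (`α₁α₂Δ` odd and
`w₁, w₂ > 2`, where no `k` survives); `|R_d| ≤ ω(d) ≤ d`; dimension `2` with an absolute constant;
level `D = z^{19}`, `z = ⌊K^{1/76}⌋ + 1` (sieving ranges capped at `z`, at the cost of the constant
`76`); and `V(z) ≤ ∏_{p<w₁,p∤α₁}(1 − 1/p) ∏_{p<w₂,p∤α₂Δ}(1 − 1/p) ≪ (α₁/φ(α₁))(α₂Δ/φ(α₂Δ))/(log w₁ log w₂)`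
by Mertens.

## References

* K. Matomäki, J. Merikoski, IMRN 2023 (arXiv:2112.11412), Lemma 3.1(i). [cite: MatomakiMerikoski2023, Lemma 3.1]
* K. Henriot, *Nair–Tenenbaum bounds uniform with respect to the discriminant*, Math. Proc. Cambridge
  Philos. Soc. 152 (2012), Lemma 6 (arXiv:1102.1643, p. 11). [Henriot2012]
* J. Friedlander, H. Iwaniec, *Opera de Cribro*, AMS Coll. Publ. 57 (2010), Thm 6.9. [FriedlanderIwaniecOpera2010]
-/

open Finset

noncomputable section

namespace Literature.NumberTheory.Sieve

namespace PairLinearSieve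

open Lichtman2020 (card_filter_range_prod_eq_prod_card totient_div_le_prod prod_primesLE_one_sub_inv_le
  card_primesLE_le_self log_sq_le_sqrt)

/-! ### Roots of a linear congruence -/

/-- The root of `αk + β ≡ 0 (mod p)` as a natural number `< p` (meaningful when `(α, p) = 1`):
`(−β α⁻¹ mod p)`. [folklore] -/
def root (α β p : ℕ) : ℕ := (-(β : ZMod p) * ((α : ZMod p)⁻¹)).val

/-- `root α β p < p` for `p > 0`. [folklore] -/
theorem root_lt {α β p : ℕ} (hp : 0 < p) : root α β p < p := by
  haveI : NeZero p := ⟨hp.ne'⟩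
  exact ZMod.val_lt _

/-- For `(α, p) = 1`, `p > 0`: `p ∣ αk + β ↔ k % p = root α β p`. [folklore] -/
theorem dvd_linear_iff_mod_eq_root {α β p : ℕ} (hp : 0 < p) (hα : Nat.Coprime α p) (k : ℕ) :
    p ∣ α * k + β ↔ k % p = root α β p := by
  haveI : NeZero p := ⟨hp.ne'⟩
  have hu : (α : ZMod p) * (α : ZMod p)⁻¹ = 1 := ZMod.coe_mul_inv_eq_one α hα
  rw [root, ← ZMod.val_natCast, ← ZMod.natCast_eq_zero_iff]
  constructor
  · intro h0
    congr 1
    push_cast at h0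
    have : (k : ZMod p) = (k : ZMod p) * ((α : ZMod p) * (α : ZMod p)⁻¹) := by rw [hu, mul_one]
    rw [this]
    linear_combination (α : ZMod p)⁻¹ * h0
  · intro hk
    have hk' : (k : ZMod p) = -(β : ZMod p) * (α : ZMod p)⁻¹ := by
      have := congrArg (fun n : ℕ => (n : ZMod p)) hk
      simpa only [ZMod.natCast_val, ZMod.cast_id', id_eq] using this
    push_cast
    rw [hk']
    linear_combination (-(β : ZMod p)) * hu

/-- If the roots of `α₁k + β₁` and `α₂k + β₂` coincide modulo a prime `p ∤ α₁α₂` then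
`p ∣ α₁β₂ − α₂β₁`. [folklore] -/
theorem dvd_det_of_root_eq {α₁ β₁ α₂ β₂ p : ℕ} (hp : p.Prime) (h₁ : Nat.Coprime α₁ p)
    (h₂ : Nat.Coprime α₂ p) (heq : root α₁ β₁ p = root α₂ β₂ p) :
    p ∣ Int.natAbs ((α₁ : ℤ) * β₂ - α₂ * β₁) := by
  haveI : NeZero p := ⟨hp.ne_zero⟩
  have hu₁ : (α₁ : ZMod p) * (α₁ : ZMod p)⁻¹ = 1 := ZMod.coe_mul_inv_eq_one α₁ h₁
  have hu₂ : (α₂ : ZMod p) * (α₂ : ZMod p)⁻¹ = 1 := ZMod.coe_mul_inv_eq_one α₂ h₂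
  have heq' : -(β₁ : ZMod p) * (α₁ : ZMod p)⁻¹ = -(β₂ : ZMod p) * (α₂ : ZMod p)⁻¹ :=
    ZMod.val_injective p heq
  rw [← Int.natCast_dvd_natCast, Int.dvd_natAbs, ← ZMod.intCast_zmod_eq_zero_iff_dvd]
  push_cast
  linear_combination ((α₁ : ZMod p) * (α₂ : ZMod p)) * heq' + ((α₂ : ZMod p) * (β₁ : ZMod p)) * hu₁
    - ((α₁ : ZMod p) * (β₂ : ZMod p)) * hu₂

/-! ### The removed classes -/

variable (w₁ w₂ : ℝ) (α₁ β₁ α₂ β₂ : ℕ)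

/-- `Δ = |α₁β₂ − α₂β₁|`. [folklore] -/
def det : ℕ := Int.natAbs ((α₁ : ℤ) * β₂ - α₂ * β₁)

/-- The residue classes removed modulo the prime `p`: the root of `ℓ₁ ≡ 0` when `p < w₁`, `p ∤ α₁`,
and the root of `ℓ₂ ≡ 0` when `p < w₂`, `p ∤ α₂Δ`. [folklore] -/
def sieveClasses (p : ℕ) : Finset ℕ :=
  (if (p : ℝ) < w₁ ∧ ¬ p ∣ α₁ then {root α₁ β₁ p} else ∅) ∪
    (if (p : ℝ) < w₂ ∧ ¬ p ∣ α₂ * det α₁ β₁ α₂ β₂ then {root α₂ β₂ p} else ∅)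

variable {w₁ w₂ α₁ β₁ α₂ β₂}

/-- The residues are `< p` (`p > 0`). [folklore] -/
theorem sieveClasses_lt {p : ℕ} (hp : 0 < p) : ∀ r ∈ sieveClasses w₁ w₂ α₁ β₁ α₂ β₂ p, r < p := by
  intro r hr
  unfold sieveClasses at hr
  rcases Finset.mem_union.mp hr with h | h <;> split_ifs at h
  · rw [Finset.mem_singleton.mp h]; exact root_lt hp
  · simp at h
  · rw [Finset.mem_singleton.mp h]; exact root_lt hp
  · simp at h

/-- At most two classes. [folklore] -/
theorem card_sieveClasses_le (p : ℕ) : #(sieveClasses w₁ w₂ α₁ β₁ α₂ β₂ p) ≤ 2 := by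
  unfold sieveClasses
  refine (Finset.card_union_le _ _).trans ?_
  have h1 : #(if (p : ℝ) < w₁ ∧ ¬ p ∣ α₁ then ({root α₁ β₁ p} : Finset ℕ) else ∅) ≤ 1 := by
    split_ifs <;> simp
  have h2 : #(if (p : ℝ) < w₂ ∧ ¬ p ∣ α₂ * det α₁ β₁ α₂ β₂ then ({root α₂ β₂ p} : Finset ℕ) else ∅) ≤ 1 := by
    split_ifs <;> simp
  omega

/-- The non-degeneracy condition at `2`: not (`α₁`, `α₂Δ` odd and `w₁, w₂ > 2`). Under it `ω(2) ≤ 1`.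
[folklore] -/
theorem card_sieveClasses_two_le
    (hnd : ¬ ((2 : ℝ) < w₁ ∧ ¬ 2 ∣ α₁ ∧ (2 : ℝ) < w₂ ∧ ¬ 2 ∣ α₂ * det α₁ β₁ α₂ β₂)) :
    #(sieveClasses w₁ w₂ α₁ β₁ α₂ β₂ 2) ≤ 1 := by
  unfold sieveClasses
  push_cast
  by_cases h1 : (2 : ℝ) < w₁ ∧ ¬ 2 ∣ α₁
  · have h2 : ¬ ((2 : ℝ) < w₂ ∧ ¬ 2 ∣ α₂ * det α₁ β₁ α₂ β₂) := fun h2 => hnd ⟨h1.1, h1.2, h2.1, h2.2⟩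
    rw [if_pos h1, if_neg h2]; simp
  · rw [if_neg h1]
    split_ifs <;> simp

/-- Membership: `k % q ∈ sieveClasses q` iff `k` is in a removed class, i.e.
(`q < w₁`, `q ∤ α₁`, `q ∣ ℓ₁(k)`) or (`q < w₂`, `q ∤ α₂Δ`, `q ∣ ℓ₂(k)`), for a prime `q`. [folklore] -/
theorem mod_mem_sieveClasses_iff {q : ℕ} (hq : q.Prime) (k : ℕ) :
    k % q ∈ sieveClasses w₁ w₂ α₁ β₁ α₂ β₂ q ↔
      (((q : ℝ) < w₁ ∧ ¬ q ∣ α₁) ∧ q ∣ α₁ * k + β₁) ∨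
        (((q : ℝ) < w₂ ∧ ¬ q ∣ α₂ * det α₁ β₁ α₂ β₂) ∧ q ∣ α₂ * k + β₂) := by
  unfold sieveClasses
  rw [Finset.mem_union]
  apply or_congr
  · split_ifs with hc
    · rw [Finset.mem_singleton, dvd_linear_iff_mod_eq_root hq.pos
        ((Nat.Coprime.symm ((Nat.Prime.coprime_iff_not_dvd hq).mpr hc.2)))]
      simp [hc]
    · simp [hc]
  · split_ifs with hc
    · have hc2 : ¬ q ∣ α₂ := fun h => hc.2 (h.mul_right _)
      rw [Finset.mem_singleton, dvd_linear_iff_mod_eq_root hq.pos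
        ((Nat.Coprime.symm ((Nat.Prime.coprime_iff_not_dvd hq).mpr hc2)))]
      simp [hc]
    · simp [hc]

/-! ### The encoding `Φ` and the sifted sequence -/

variable (w₁ w₂ α₁ β₁ α₂ β₂)

/-- `Φ(k) = ∏_{p<w₁, p∤α₁, p∣ℓ₁(k)} p · ∏_{p<w₂, p∤α₂Δ, p∣ℓ₂(k)} p`. [folklore] -/
def encode (k : ℕ) : ℕ :=
  (∏ p ∈ (α₁ * k + β₁).primeFactors with (((p : ℕ) : ℝ) < w₁ ∧ ¬ p ∣ α₁), p) *
    ∏ p ∈ (α₂ * k + β₂).primeFactors with (((p : ℕ) : ℝ) < w₂ ∧ ¬ p ∣ α₂ * det α₁ β₁ α₂ β₂), p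

variable {w₁ w₂ α₁ β₁ α₂ β₂}

/-- A prime `q` divides `Φ(k)` iff `k` lies in a removed class modulo `q` (`ℓ₁(k), ℓ₂(k) ≠ 0`).
[folklore] -/
theorem prime_dvd_encode_iff {q : ℕ} (hq : q.Prime) {k : ℕ} (h₁ : α₁ * k + β₁ ≠ 0)
    (h₂ : α₂ * k + β₂ ≠ 0) :
    q ∣ encode w₁ w₂ α₁ β₁ α₂ β₂ k ↔
      (((q : ℝ) < w₁ ∧ ¬ q ∣ α₁) ∧ q ∣ α₁ * k + β₁) ∨
        (((q : ℝ) < w₂ ∧ ¬ q ∣ α₂ * det α₁ β₁ α₂ β₂) ∧ q ∣ α₂ * k + β₂) := by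
  unfold encode
  rw [hq.dvd_mul, Prime.dvd_finsetProd_iff hq.prime, Prime.dvd_finsetProd_iff hq.prime]
  apply or_congr
  · constructor
    · rintro ⟨p, hp, hqp⟩
      rw [Finset.mem_filter, Nat.mem_primeFactors] at hp
      obtain rfl := (Nat.prime_dvd_prime_iff_eq hq hp.1.1).mp hqp
      exact ⟨hp.2, hp.1.2.1⟩
    · rintro ⟨hc, hdvd⟩
      exact ⟨q, Finset.mem_filter.mpr ⟨Nat.mem_primeFactors.mpr ⟨hq, hdvd, h₁⟩, hc⟩, dvd_rfl⟩
  · constructor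
    · rintro ⟨p, hp, hqp⟩
      rw [Finset.mem_filter, Nat.mem_primeFactors] at hp
      obtain rfl := (Nat.prime_dvd_prime_iff_eq hq hp.1.1).mp hqp
      exact ⟨hp.2, hp.1.2.1⟩
    · rintro ⟨hc, hdvd⟩
      exact ⟨q, Finset.mem_filter.mpr ⟨Nat.mem_primeFactors.mpr ⟨hq, hdvd, h₂⟩, hc⟩, dvd_rfl⟩

/-- The same, as membership of `k % q` in the removed classes. [folklore] -/
theorem prime_dvd_encode_iff_mod_mem {q : ℕ} (hq : q.Prime) {k : ℕ} (h₁ : α₁ * k + β₁ ≠ 0)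
    (h₂ : α₂ * k + β₂ ≠ 0) :
    q ∣ encode w₁ w₂ α₁ β₁ α₂ β₂ k ↔ k % q ∈ sieveClasses w₁ w₂ α₁ β₁ α₂ β₂ q := by
  rw [prime_dvd_encode_iff hq h₁ h₂, mod_mem_sieveClasses_iff hq]

/-- `Φ(k) > 0`. [folklore] -/
theorem encode_pos (k : ℕ) : 0 < encode w₁ w₂ α₁ β₁ α₂ β₂ k :=
  Nat.mul_pos
    (Finset.prod_pos fun _ hp => (Nat.prime_of_mem_primeFactors (Finset.mem_filter.mp hp).1).pos)
    (Finset.prod_pos fun _ hp => (Nat.prime_of_mem_primeFactors (Finset.mem_filter.mp hp).1).pos)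

/-- `Φ(k) ≤ ℓ₁(k) ℓ₂(k)` (when both are nonzero). [folklore] -/
theorem encode_le {k : ℕ} (h₁ : α₁ * k + β₁ ≠ 0) (h₂ : α₂ * k + β₂ ≠ 0) :
    encode w₁ w₂ α₁ β₁ α₂ β₂ k ≤ (α₁ * k + β₁) * (α₂ * k + β₂) := by
  unfold encode
  refine Nat.mul_le_mul ?_ ?_
  · exact Nat.le_of_dvd (Nat.pos_of_ne_zero h₁)
      ((Finset.prod_dvd_prod_of_subset _ _ _ (Finset.filter_subset _ _)).trans
        (Nat.prod_primeFactors_dvd _))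
  · exact Nat.le_of_dvd (Nat.pos_of_ne_zero h₂)
      ((Finset.prod_dvd_prod_of_subset _ _ _ (Finset.filter_subset _ _)).trans
        (Nat.prod_primeFactors_dvd _))

/-- For squarefree `d`: `d ∣ Φ(k)` iff `k % q` is a removed class for every prime `q ∣ d`. [folklore] -/
theorem dvd_encode_iff_of_squarefree {d : ℕ} (hd : Squarefree d) {k : ℕ} (h₁ : α₁ * k + β₁ ≠ 0)
    (h₂ : α₂ * k + β₂ ≠ 0) :
    d ∣ encode w₁ w₂ α₁ β₁ α₂ β₂ k ↔
      ∀ q ∈ d.primeFactors, k % q ∈ sieveClasses w₁ w₂ α₁ β₁ α₂ β₂ q := by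
  constructor
  · intro hdvd q hq
    exact (prime_dvd_encode_iff_mod_mem (Nat.prime_of_mem_primeFactors hq) h₁ h₂).mp
      ((Nat.dvd_of_mem_primeFactors hq).trans hdvd)
  · intro H
    rw [← Nat.prod_primeFactors_of_squarefree hd]
    exact Finset.prod_primes_dvd _ (fun q hq => (Nat.prime_of_mem_primeFactors hq).prime)
      (fun q hq => (prime_dvd_encode_iff_mod_mem (Nat.prime_of_mem_primeFactors hq) h₁ h₂).mpr (H q hq))

variable (w₁ w₂ α₁ β₁ α₂ β₂)

/-- The density `g(d) = ∏_{p ∣ d} ω(p)/p` (`g(0) = 0`). [folklore] -/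
def densityFn (d : ℕ) : ℝ :=
  if d = 0 then 0 else ∏ p ∈ d.primeFactors, ((#(sieveClasses w₁ w₂ α₁ β₁ α₂ β₂ p) : ℝ) / p)

/-- The density as an arithmetic function. [folklore] -/
def density : ArithmeticFunction ℝ :=
  ⟨densityFn w₁ w₂ α₁ β₁ α₂ β₂, by simp [densityFn]⟩

variable {w₁ w₂ α₁ β₁ α₂ β₂}

/-- `g(d) = ∏_{p ∣ d} ω(p)/p` for `d ≠ 0`. [folklore] -/
theorem density_apply {d : ℕ} (hd : d ≠ 0) :
    density w₁ w₂ α₁ β₁ α₂ β₂ d =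
      ∏ p ∈ d.primeFactors, ((#(sieveClasses w₁ w₂ α₁ β₁ α₂ β₂ p) : ℝ) / p) := by
  show densityFn w₁ w₂ α₁ β₁ α₂ β₂ d = _
  rw [densityFn, if_neg hd]

/-- `g(p) = ω(p)/p` at a prime. [folklore] -/
theorem density_prime {p : ℕ} (hp : p.Prime) :
    density w₁ w₂ α₁ β₁ α₂ β₂ p = (#(sieveClasses w₁ w₂ α₁ β₁ α₂ β₂ p) : ℝ) / p := by
  rw [density_apply hp.ne_zero, hp.primeFactors, Finset.prod_singleton]

/-- `g` is multiplicative. [folklore] -/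
theorem isMultiplicative_density : (density w₁ w₂ α₁ β₁ α₂ β₂).IsMultiplicative := by
  refine ⟨?_, ?_⟩
  · rw [density_apply one_ne_zero, Nat.primeFactors_one, Finset.prod_empty]
  · intro m n hmn
    rcases Nat.eq_zero_or_pos m with rfl | hm
    · simp
    rcases Nat.eq_zero_or_pos n with rfl | hn'
    · simp
    rw [density_apply (Nat.mul_ne_zero hm.ne' hn'.ne'), density_apply hm.ne', density_apply hn'.ne',
      Nat.primeFactors_mul hm.ne' hn'.ne', Finset.prod_union hmn.disjoint_primeFactors]

variable (w₁ w₂ α₁ β₁ α₂ β₂)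

/-- The sifted sequence: weights `a_m = #{k ≤ K : Φ(k) = m}`, size `K`, density `g`. [folklore] -/
def seq (K : ℕ) : SieveSequence where
  a m := (#{k ∈ Icc 1 K | encode w₁ w₂ α₁ β₁ α₂ β₂ k = m} : ℝ)
  a_nonneg _ := Nat.cast_nonneg _
  size _ := K
  density := density w₁ w₂ α₁ β₁ α₂ β₂
  density_mult := isMultiplicative_density

variable {w₁ w₂ α₁ β₁ α₂ β₂}

/-- Unfolding the weights. [folklore] -/
theorem seq_a (K m : ℕ) :
    (seq w₁ w₂ α₁ β₁ α₂ β₂ K).a m = (#{k ∈ Icc 1 K | encode w₁ w₂ α₁ β₁ α₂ β₂ k = m} : ℝ) := rfl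

/-- Unfolding the size. [folklore] -/
theorem seq_size (K : ℕ) (x : ℝ) : (seq w₁ w₂ α₁ β₁ α₂ β₂ K).size x = K := rfl

/-- Unfolding the density. [folklore] -/
theorem seq_density (K : ℕ) : (seq w₁ w₂ α₁ β₁ α₂ β₂ K).density = density w₁ w₂ α₁ β₁ α₂ β₂ := rfl

/-- For `k ≥ 1` and `α ≥ 1`: `αk + β ≠ 0`. [folklore] -/
theorem linear_ne_zero {α β k : ℕ} (hα : 1 ≤ α) (hk : 1 ≤ k) : α * k + β ≠ 0 := by
  have : 1 ≤ α * k := Nat.one_le_iff_ne_zero.mpr (Nat.mul_ne_zero (by omega) (by omega))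
  omega

/-- Fibre count: for `N ≥ (α₁K+β₁)(α₂K+β₂) ≥ max Φ`, summing the weights over `m ≤ N` with `C m`
counts the `k ≤ K` with `C (Φ k)`. [folklore] -/
theorem sum_a_filter_eq (hα₁ : 1 ≤ α₁) (hα₂ : 1 ≤ α₂) {K N : ℕ}
    (hN : (α₁ * K + β₁) * (α₂ * K + β₂) ≤ N) (C : ℕ → Prop) [DecidablePred C] :
    ∑ m ∈ (Ioc 0 N).filter C, (seq w₁ w₂ α₁ β₁ α₂ β₂ K).a m =
      #{k ∈ Icc 1 K | C (encode w₁ w₂ α₁ β₁ α₂ β₂ k)} := by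
  simp only [seq_a]
  rw [← Nat.cast_sum, Nat.cast_inj]
  rw [Finset.card_eq_sum_card_fiberwise (f := encode w₁ w₂ α₁ β₁ α₂ β₂)
    (s := {k ∈ Icc 1 K | C (encode w₁ w₂ α₁ β₁ α₂ β₂ k)}) (t := (Ioc 0 N).filter C) ?_]
  · refine Finset.sum_congr rfl fun m hm => ?_
    have hCm : C m := (Finset.mem_filter.mp hm).2
    congr 1
    ext k
    simp only [Finset.mem_filter]
    constructor
    · rintro ⟨h1, h3⟩
      exact ⟨⟨h1, by rw [h3]; exact hCm⟩, h3⟩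
    · rintro ⟨⟨h1, _⟩, h3⟩
      exact ⟨h1, h3⟩
  · intro k hk
    have hk' : k ∈ {k ∈ Icc 1 K | C (encode w₁ w₂ α₁ β₁ α₂ β₂ k)} := hk
    rw [Finset.mem_filter, Finset.mem_Icc] at hk'
    show encode w₁ w₂ α₁ β₁ α₂ β₂ k ∈ (Ioc 0 N).filter C
    rw [Finset.mem_filter, Finset.mem_Ioc]
    refine ⟨⟨encode_pos k, ?_⟩, hk'.2⟩
    have h₁ := linear_ne_zero (β := β₁) hα₁ hk'.1.1
    have h₂ := linear_ne_zero (β := β₂) hα₂ hk'.1.1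
    refine (encode_le h₁ h₂).trans (le_trans (Nat.mul_le_mul ?_ ?_) hN)
    · exact Nat.add_le_add_right (Nat.mul_le_mul_left _ hk'.1.2) _
    · exact Nat.add_le_add_right (Nat.mul_le_mul_left _ hk'.1.2) _

/-- The congruence sums of the sequence count `k ≤ K` with `d ∣ Φ(k)`. [folklore] -/
theorem seq_congrSum (hα₁ : 1 ≤ α₁) (hα₂ : 1 ≤ α₂) {K N : ℕ}
    (hN : (α₁ * K + β₁) * (α₂ * K + β₂) ≤ N) (d : ℕ) :
    (seq w₁ w₂ α₁ β₁ α₂ β₂ K).congrSum d N = #{k ∈ Icc 1 K | d ∣ encode w₁ w₂ α₁ β₁ α₂ β₂ k} := by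
  rw [SieveSequence.congrSum, Nat.floor_natCast]
  exact sum_a_filter_eq hα₁ hα₂ hN (d ∣ ·)

/-- The sifting function of the sequence counts `k ≤ K` with `(Φ(k), P) = 1`. [folklore] -/
theorem seq_sifted (hα₁ : 1 ≤ α₁) (hα₂ : 1 ≤ α₂) {K N : ℕ}
    (hN : (α₁ * K + β₁) * (α₂ * K + β₂) ≤ N) (Pz : ℕ) :
    (seq w₁ w₂ α₁ β₁ α₂ β₂ K).sifted N Pz = #{k ∈ Icc 1 K | (encode w₁ w₂ α₁ β₁ α₂ β₂ k).Coprime Pz} := by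
  rw [SieveSequence.sifted, Nat.floor_natCast]
  exact sum_a_filter_eq hα₁ hα₂ hN (fun n => n.Coprime Pz)

/-- **Level of distribution**: for squarefree `d`, `|R_d| ≤ ω(d) ≤ d` (periodicity modulo `d` and the
Chinese remainder count). [folklore] -/
theorem abs_remainder_le (hα₁ : 1 ≤ α₁) (hα₂ : 1 ≤ α₂) {K N : ℕ}
    (hN : (α₁ * K + β₁) * (α₂ * K + β₂) ≤ N) {d : ℕ} (hd : Squarefree d) :
    |(seq w₁ w₂ α₁ β₁ α₂ β₂ K).remainder d N| ≤ d := by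
  have hd0 : 0 < d := Nat.pos_of_ne_zero hd.ne_zero
  set cond : ℕ → Prop := fun k => ∀ q ∈ d.primeFactors, k % q ∈ sieveClasses w₁ w₂ α₁ β₁ α₂ β₂ q
    with hcond
  have hfilter : {k ∈ Icc 1 K | d ∣ encode w₁ w₂ α₁ β₁ α₂ β₂ k} = {k ∈ Icc 1 K | cond k} := by
    refine Finset.filter_congr fun k hk => ?_
    rw [Finset.mem_Icc] at hk
    exact dvd_encode_iff_of_squarefree hd (linear_ne_zero hα₁ hk.1) (linear_ne_zero hα₂ hk.1)
  have hper : Function.Periodic cond d := by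
    intro n
    simp only [hcond, eq_iff_iff]
    refine forall₂_congr fun q hq => ?_
    obtain ⟨c, hc⟩ := Nat.dvd_of_mem_primeFactors hq
    rw [show (n + d) % q = n % q by rw [hc, Nat.add_mul_mod_self_left]]
  have hcount : Nat.count cond d = ∏ q ∈ d.primeFactors, #(sieveClasses w₁ w₂ α₁ β₁ α₂ β₂ q) := by
    rw [Nat.count_eq_card_filter_range]
    have := card_filter_range_prod_eq_prod_card d.primeFactors
      (fun q hq => Nat.prime_of_mem_primeFactors hq) (sieveClasses w₁ w₂ α₁ β₁ α₂ β₂)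
      (fun q hq => sieveClasses_lt (Nat.prime_of_mem_primeFactors hq).pos)
    rw [Nat.prod_primeFactors_of_squarefree hd] at this
    exact this
  have hcle : Nat.count cond d ≤ d := Nat.count_le _
  have hmain := BrunTwinPrimes.abs_card_filter_Icc_sub_le hd0 cond hper K
  have hdcast : (d : ℝ) = ∏ q ∈ d.primeFactors, (q : ℝ) := by
    rw [← Nat.cast_prod, Nat.prod_primeFactors_of_squarefree hd]
  have hdens : (seq w₁ w₂ α₁ β₁ α₂ β₂ K).density d * (seq w₁ w₂ α₁ β₁ α₂ β₂ K).size N =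
      (K : ℝ) * (Nat.count cond d : ℝ) / d := by
    rw [seq_density, seq_size, density_apply hd.ne_zero, Finset.prod_div_distrib, ← hdcast, hcount]
    push_cast
    ring
  rw [SieveSequence.remainder, seq_congrSum hα₁ hα₂ hN, hfilter, hdens]
  have hcle' : (Nat.count cond d : ℝ) ≤ d := by exact_mod_cast hcle
  exact hmain.trans hcle'

/-! ### The local factors of `V(z)` -/

/-- The comparison factor of form `i`: `1 − 1/p` on the primes where form `i` removes a class, else `1`.
[folklore] -/
def weight (w : ℝ) (E p : ℕ) : ℝ := if (p : ℝ) < w ∧ ¬ p ∣ E then 1 - 1 / (p : ℝ) else 1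

/-- `0 ≤ weight ≤ 1`. [folklore] -/
theorem weight_nonneg {w : ℝ} {E p : ℕ} (hp : p.Prime) : 0 ≤ weight w E p := by
  unfold weight; split_ifs
  · have h2 : (2 : ℝ) ≤ p := by exact_mod_cast hp.two_le
    have : 1 / (p : ℝ) ≤ 1 / 2 := one_div_le_one_div_of_le (by norm_num) h2
    linarith
  · norm_num

/-- `weight ≤ 1`. [folklore] -/
theorem weight_le_one {w : ℝ} {E p : ℕ} : weight w E p ≤ 1 := by
  unfold weight; split_ifs
  · have : 0 ≤ 1 / (p : ℝ) := by positivity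
    linarith
  · exact le_rfl

/-- **The local factor**: `1 − ω(p)/p ≤ weight₁(p) · weight₂(p)` for a prime `p` — when both classes are
present they are distinct (`p ∤ Δ`), so `ω(p) = 2` and `1 − 2/p ≤ (1 − 1/p)²`. [folklore] -/
theorem one_sub_card_div_le {p : ℕ} (hp : p.Prime) :
    1 - (#(sieveClasses w₁ w₂ α₁ β₁ α₂ β₂ p) : ℝ) / p ≤
      weight w₁ α₁ p * weight w₂ (α₂ * det α₁ β₁ α₂ β₂) p := by
  have hp2 : (2 : ℝ) ≤ p := by exact_mod_cast hp.two_le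
  have hp0 : (0 : ℝ) < p := by linarith
  unfold sieveClasses weight
  by_cases c1 : (p : ℝ) < w₁ ∧ ¬ p ∣ α₁ <;> by_cases c2 : (p : ℝ) < w₂ ∧ ¬ p ∣ α₂ * det α₁ β₁ α₂ β₂
  · rw [if_pos c1, if_pos c2, if_pos c1, if_pos c2]
    -- distinct roots
    have hne : root α₁ β₁ p ≠ root α₂ β₂ p := by
      intro heq
      have hc1 : Nat.Coprime α₁ p := Nat.Coprime.symm ((Nat.Prime.coprime_iff_not_dvd hp).mpr c1.2)
      have hα₂ : ¬ p ∣ α₂ := fun h => c2.2 (h.mul_right _)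
      have hc2 : Nat.Coprime α₂ p := Nat.Coprime.symm ((Nat.Prime.coprime_iff_not_dvd hp).mpr hα₂)
      exact c2.2 ((dvd_det_of_root_eq hp hc1 hc2 heq).mul_left _)
    rw [Finset.card_union_of_disjoint (Finset.disjoint_singleton.mpr hne), Finset.card_singleton,
      Finset.card_singleton]
    push_cast
    have key : (1 - 1 / (p : ℝ)) * (1 - 1 / (p : ℝ)) = (1 - 2 / p) + (1 / p) ^ 2 := by ring
    rw [key]
    nlinarith [sq_nonneg (1 / (p : ℝ))]
  · rw [if_pos c1, if_neg c2, if_pos c1, if_neg c2]; simp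
  · rw [if_neg c1, if_pos c2, if_neg c1, if_pos c2]; simp
  · rw [if_neg c1, if_neg c2, if_neg c1, if_neg c2]; simp

/-- Nonnegativity of the local factor (`ω(2) ≤ 1`, `ω(p) ≤ 2 < p` otherwise). [folklore] -/
theorem one_sub_card_div_nonneg {p : ℕ} (hp : p.Prime) (h2 : #(sieveClasses w₁ w₂ α₁ β₁ α₂ β₂ 2) ≤ 1) :
    0 ≤ 1 - (#(sieveClasses w₁ w₂ α₁ β₁ α₂ β₂ p) : ℝ) / p := by
  rw [sub_nonneg, div_le_one (by exact_mod_cast hp.pos)]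
  by_cases hp2 : p = 2
  · subst hp2; exact_mod_cast h2.trans (by norm_num)
  · have h3 : 3 ≤ p := by have := hp.two_le; omega
    exact_mod_cast (card_sieveClasses_le (w₁ := w₁) (w₂ := w₂) (α₁ := α₁) (β₁ := β₁) (α₂ := α₂) (β₂ := β₂) p).trans (by omega)

/-- The density at a prime is `< 1` (given `ω(2) ≤ 1`). [folklore] -/
theorem card_div_lt_one {p : ℕ} (hp : p.Prime) (h2 : #(sieveClasses w₁ w₂ α₁ β₁ α₂ β₂ 2) ≤ 1) :
    (#(sieveClasses w₁ w₂ α₁ β₁ α₂ β₂ p) : ℝ) / p < 1 := by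
  rw [div_lt_one (by exact_mod_cast hp.pos)]
  by_cases hp2 : p = 2
  · subst hp2; exact_mod_cast lt_of_le_of_lt h2 (by norm_num)
  · have h3 : 3 ≤ p := by have := hp.two_le; omega
    exact_mod_cast lt_of_le_of_lt (card_sieveClasses_le (w₁ := w₁) (w₂ := w₂) (α₁ := α₁) (β₁ := β₁) (α₂ := α₂) (β₂ := β₂) p) (by omega)

/-! ### Sieve dimension two -/

/-- **Dimension `2` with an absolute constant**: given `ω(2) ≤ 1`, `0 ≤ g(p) < 1` and
`∏_{w ≤ p < z} (1 − g(p))⁻¹ ≤ 2e^{17+12/log 2} (log z/log w)²` (as in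
`Lichtman2020.hasSieveDimension_density`: `ω(p) ≤ 2` and Mertens over the window). [folklore] -/
theorem hasSieveDimension_density (h2 : #(sieveClasses w₁ w₂ α₁ β₁ α₂ β₂ 2) ≤ 1) :
    HasSieveDimension (density w₁ w₂ α₁ β₁ α₂ β₂) 2 (2 * Real.exp (17 + 12 / Real.log 2)) := by
  have hg : ∀ p : ℕ, p.Prime → 0 ≤ density w₁ w₂ α₁ β₁ α₂ β₂ p ∧ density w₁ w₂ α₁ β₁ α₂ β₂ p < 1 :=
    fun p hp => by
      rw [density_prime hp]
      exact ⟨by positivity, card_div_lt_one hp h2⟩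
  refine ⟨hg, fun w z hw hwz => ?_⟩
  set S := (Nat.primesBelow ⌈z⌉₊).filter (fun p : ℕ => w ≤ (p : ℝ)) with hS
  have hlogw : 0 < Real.log w := Real.log_pos (by linarith)
  have hlogz : 0 < Real.log z := Real.log_pos (by linarith)
  have hmemS : ∀ p ∈ S, p.Prime ∧ w ≤ (p : ℝ) ∧ p ≤ ⌊z⌋₊ := by
    intro p hp
    rw [hS, Finset.mem_filter, Nat.mem_primesBelow] at hp
    exact ⟨hp.1.2, hp.2, Nat.le_floor (Nat.lt_ceil.mp hp.1.1).le⟩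
  have hSle : S ⊆ Nat.primesLE ⌊z⌋₊ := fun p hp =>
    Nat.mem_primesLE.mpr ⟨(hmemS p hp).2.2, (hmemS p hp).1⟩
  set F : ℕ → ℝ := fun p => Real.exp (2 / (p : ℝ) + 8 * (1 / ((p : ℝ) * ((p : ℝ) - 1)))) with hF
  have hF1 : ∀ p ∈ S, 1 ≤ F p := fun p hp => by
    have hp2 : (2 : ℝ) ≤ p := by exact_mod_cast (hmemS p hp).1.two_le
    have : (0 : ℝ) < (p : ℝ) * ((p : ℝ) - 1) := mul_pos (by linarith) (by linarith)
    exact Real.one_le_exp (by positivity)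
  have hpt : ∀ p ∈ S, (1 - density w₁ w₂ α₁ β₁ α₂ β₂ p)⁻¹ ≤ (if p = 2 then (2 : ℝ) else 1) * F p := by
    intro p hp
    have hpp := (hmemS p hp).1
    rw [density_prime hpp]
    by_cases hp2 : p = 2
    · subst hp2
      rw [if_pos rfl]
      have hc1 : (#(sieveClasses w₁ w₂ α₁ β₁ α₂ β₂ 2) : ℝ) ≤ 1 := by exact_mod_cast h2
      calc (1 - (#(sieveClasses w₁ w₂ α₁ β₁ α₂ β₂ 2) : ℝ) / (2 : ℕ))⁻¹ ≤ (1 - 1 / 2)⁻¹ := by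
            apply inv_anti₀ (by norm_num)
            push_cast
            linarith
        _ = 2 := by norm_num
        _ ≤ 2 * F 2 := le_mul_of_one_le_right (by norm_num) (hF1 2 hp)
    · rw [if_neg hp2, one_mul]
      have hp3 : 3 ≤ p := by have := hpp.two_le; omega
      have hp3' : (3 : ℝ) ≤ p := by exact_mod_cast hp3
      have hcard : (#(sieveClasses w₁ w₂ α₁ β₁ α₂ β₂ p) : ℝ) ≤ 2 := by
        exact_mod_cast card_sieveClasses_le (w₁ := w₁) (w₂ := w₂) (α₁ := α₁) (β₁ := β₁) (α₂ := α₂) (β₂ := β₂) p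
      have hc : (#(sieveClasses w₁ w₂ α₁ β₁ α₂ β₂ p) : ℝ) / p ≤ 2 / p :=
        div_le_div_of_nonneg_right hcard (by linarith)
      have h23 : 2 / (p : ℝ) ≤ 2 / 3 := div_le_div_of_nonneg_left (by norm_num) (by norm_num) hp3'
      calc (1 - (#(sieveClasses w₁ w₂ α₁ β₁ α₂ β₂ p) : ℝ) / p)⁻¹ ≤ (1 - 2 / (p : ℝ))⁻¹ :=
            inv_anti₀ (by linarith) (by linarith)
        _ ≤ F p := Lichtman2020.inv_one_sub_two_div_le_exp hp3'
  have hnonneg : ∀ p ∈ S, 0 ≤ (1 - density w₁ w₂ α₁ β₁ α₂ β₂ p)⁻¹ := fun p hp =>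
    inv_nonneg.mpr (sub_nonneg.mpr (hg p (hmemS p hp).1).2.le)
  have hsum1 : ∑ p ∈ S, (1 : ℝ) / p ≤
      Real.log (Real.log z) - Real.log (Real.log w) + (9 / 2 + 6 / Real.log 2) :=
    sum_primesWindow_one_div_le hw hwz
  have hsum2 : ∑ p ∈ S, (1 : ℝ) / (p * (p - 1)) ≤ 1 :=
    (Finset.sum_le_sum_of_subset_of_nonneg hSle fun p hp _ => by
      have hp2 : (2 : ℝ) ≤ p := by exact_mod_cast (Nat.mem_primesLE.mp hp).2.two_le
      have : (0 : ℝ) < p * (p - 1) := mul_pos (by linarith) (by linarith)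
      positivity).trans
      (LFunctions.MertensBound.sum_inv_prime_mul_pred_le_one ⌊z⌋₊)
  have hprod2 : ∏ p ∈ S, (if p = 2 then (2 : ℝ) else 1) ≤ 2 := by
    have : ∏ p ∈ S, (if p = 2 then (2 : ℝ) else 1) = if 2 ∈ S then 2 else 1 :=
      Finset.prod_ite_eq' S 2 (fun _ => (2 : ℝ))
    rw [this]
    split_ifs <;> norm_num
  have hE : Real.exp (Real.log (Real.log z) - Real.log (Real.log w)) = Real.log z / Real.log w := by
    rw [Real.exp_sub, Real.exp_log hlogz, Real.exp_log hlogw]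
  calc ∏ p ∈ S, (1 - density w₁ w₂ α₁ β₁ α₂ β₂ p)⁻¹
      ≤ ∏ p ∈ S, ((if p = 2 then (2 : ℝ) else 1) * F p) := Finset.prod_le_prod hnonneg hpt
    _ = (∏ p ∈ S, (if p = 2 then (2 : ℝ) else 1)) * ∏ p ∈ S, F p := Finset.prod_mul_distrib
    _ ≤ 2 * ∏ p ∈ S, F p :=
        mul_le_mul_of_nonneg_right hprod2 (Finset.prod_nonneg fun p _ => (Real.exp_pos _).le)
    _ = 2 * Real.exp (∑ p ∈ S, (2 / (p : ℝ) + 8 * (1 / ((p : ℝ) * ((p : ℝ) - 1))))) := by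
        rw [hF, Real.exp_sum]
    _ = 2 * Real.exp (2 * ∑ p ∈ S, 1 / (p : ℝ) + 8 * ∑ p ∈ S, 1 / ((p : ℝ) * ((p : ℝ) - 1))) := by
        rw [Finset.sum_add_distrib, Finset.mul_sum, Finset.mul_sum]
        congr 3
        refine Finset.sum_congr rfl fun p _ => ?_
        rw [mul_one_div]
    _ ≤ 2 * Real.exp (2 * (Real.log (Real.log z) - Real.log (Real.log w) + (9 / 2 + 6 / Real.log 2))
          + 8 * 1) :=
        mul_le_mul_of_nonneg_left (Real.exp_le_exp.mpr (by linarith)) (by norm_num)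
    _ = 2 * Real.exp ((17 + 12 / Real.log 2) +
          ((Real.log (Real.log z) - Real.log (Real.log w)) +
            (Real.log (Real.log z) - Real.log (Real.log w)))) := by
        congr 2; ring
    _ = 2 * Real.exp (17 + 12 / Real.log 2) * (Real.log z / Real.log w) ^ (2 : ℝ) := by
        rw [Real.exp_add (17 + 12 / Real.log 2),
          Real.exp_add (Real.log (Real.log z) - Real.log (Real.log w)), hE, Real.rpow_two]
        ring

/-! ### Mertens for the partial products -/

/-- `∏_{p ≤ M, p < w} (1 − 1/p) ≤ 2e^{6/log 2}/log w` for `2 ≤ w ≤ M + 1` (Mertens; for `w < 3` the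
product is `≤ 1 ≤ 2e^{6/log 2}/log 3`). [folklore] -/
theorem prod_filter_lt_le {M : ℕ} {w : ℝ} (hw : 2 ≤ w) (hwM : w ≤ (M : ℝ) + 1) :
    ∏ p ∈ (Nat.primesLE M).filter (fun p : ℕ => (p : ℝ) < w), (1 - 1 / (p : ℝ)) ≤
      2 * Real.exp (6 / Real.log 2) / Real.log w := by
  have hl2 : (0.6931471803 : ℝ) < Real.log 2 := Real.log_two_gt_d9
  have hl2' : Real.log 2 < 0.6931471808 := Real.log_two_lt_d9
  have hlogw : 0 < Real.log w := Real.log_pos (by linarith)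
  have hE1 : 1 ≤ Real.exp (6 / Real.log 2) := Real.one_le_exp (by positivity)
  have hprod1 : ∏ p ∈ (Nat.primesLE M).filter (fun p : ℕ => (p : ℝ) < w), (1 - 1 / (p : ℝ)) ≤ 1 := by
    refine Finset.prod_le_one (fun p hp => ?_) (fun p hp => ?_)
    · have h2 : (2 : ℝ) ≤ p := by
        exact_mod_cast (Nat.mem_primesLE.mp (Finset.mem_filter.mp hp).1).2.two_le
      have : 1 / (p : ℝ) ≤ 1 / 2 := one_div_le_one_div_of_le (by norm_num) h2
      linarith
    · have : 0 ≤ 1 / (p : ℝ) := by positivity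
      linarith
  by_cases hw3 : w < 3
  · -- small `w`: `log w < log 3 ≤ 2 log 2 · …`
    have hlog3 : Real.log w ≤ 2 := by
      have h9 : Real.log w ≤ Real.log 4 := Real.log_le_log (by linarith) (by linarith)
      rw [show (4 : ℝ) = 2 ^ 2 by norm_num, Real.log_pow] at h9
      push_cast at h9
      linarith
    calc ∏ p ∈ (Nat.primesLE M).filter (fun p : ℕ => (p : ℝ) < w), (1 - 1 / (p : ℝ)) ≤ 1 := hprod1
      _ ≤ 2 * Real.exp (6 / Real.log 2) / Real.log w := by
          rw [le_div_iff₀ hlogw]; nlinarith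
  push Not at hw3
  -- `w ≥ 3`: the primes `p ≤ M`, `p < w` are exactly the primes `≤ ⌈w⌉ − 1`
  have hwc : w ≤ ⌈w⌉₊ := Nat.le_ceil w
  have hc3 : 3 ≤ ⌈w⌉₊ := by exact_mod_cast hw3.trans hwc
  have hcM : ⌈w⌉₊ ≤ M + 1 := Nat.ceil_le.mpr (by exact_mod_cast hwM)
  set n : ℕ := ⌈w⌉₊ - 1 with hn
  have hn2 : 2 ≤ n := by omega
  have hnM : n ≤ M := by omega
  have hnR : (n : ℝ) = ⌈w⌉₊ - 1 := by rw [hn, Nat.cast_sub (by omega)]; simp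
  have hset : (Nat.primesLE M).filter (fun p : ℕ => (p : ℝ) < w) = Nat.primesLE n := by
    ext p
    simp only [Finset.mem_filter, Nat.mem_primesLE]
    constructor
    · rintro ⟨⟨-, hp⟩, hpw⟩
      have : p < ⌈w⌉₊ := Nat.lt_ceil.mpr hpw
      exact ⟨by omega, hp⟩
    · rintro ⟨hpn, hp⟩
      have : p < ⌈w⌉₊ := by omega
      exact ⟨⟨by omega, hp⟩, Nat.lt_ceil.mp this⟩
  rw [hset]
  have hM := prod_primesLE_one_sub_inv_le hn2
  -- `log n ≥ log (w - 1) ≥ (log w)/2`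
  have hn1 : w - 1 ≤ n := by rw [hnR]; linarith
  have hsq : Real.sqrt w ≤ w - 1 := by
    rw [Real.sqrt_le_left (by linarith)]; nlinarith
  have hlogn : Real.log w / 2 ≤ Real.log n := by
    have h1 : Real.log (Real.sqrt w) ≤ Real.log n :=
      Real.log_le_log (Real.sqrt_pos.mpr (by linarith)) (hsq.trans hn1)
    rw [Real.log_sqrt (by linarith)] at h1
    exact h1
  have hlogn0 : 0 < Real.log n := lt_of_lt_of_le (by positivity) hlogn
  calc ∏ p ∈ Nat.primesLE n, (1 - 1 / (p : ℝ)) ≤ Real.exp (6 / Real.log 2) * (Real.log 2 / Real.log n) := hM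
    _ ≤ Real.exp (6 / Real.log 2) * (1 / (Real.log w / 2)) := by
        refine mul_le_mul_of_nonneg_left ?_ (by positivity)
        rw [div_le_div_iff₀ hlogn0 (by positivity)]
        nlinarith
    _ = 2 * Real.exp (6 / Real.log 2) / Real.log w := by
        field_simp

/-- With an excluded modulus `E ≠ 0`: `∏_{p ≤ M, p < w, p ∤ E} (1 − 1/p) ≤ (2e^{6/log 2}/log w) · E/φ(E)`
(`φ(E)/E = ∏_{p∣E}(1 − 1/p) ≤ ∏_{p∣E, p<w, p≤M}(1 − 1/p)`). [folklore] -/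
theorem prod_weight_le {M : ℕ} {w : ℝ} (hw : 2 ≤ w) (hwM : w ≤ (M : ℝ) + 1) {E : ℕ} (hE : E ≠ 0) :
    ∏ p ∈ Nat.primesLE M, weight w E p ≤
      2 * Real.exp (6 / Real.log 2) / Real.log w * ((E : ℝ) / Nat.totient E) := by
  have hlogw : 0 < Real.log w := Real.log_pos (by linarith)
  set PP : Finset ℕ := (Nat.primesLE M).filter (fun p : ℕ => (p : ℝ) < w) with hPP
  have hcprod : ∏ p ∈ Nat.primesLE M, weight w E p = ∏ p ∈ PP with ¬ p ∣ E, (1 - 1 / (p : ℝ)) := by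
    rw [Finset.prod_filter, Finset.prod_filter]
    refine Finset.prod_congr rfl fun p _ => ?_
    unfold weight
    by_cases h1 : (p : ℝ) < w
    · by_cases h2 : p ∣ E
      · rw [if_neg (fun h' => h'.2 h2), if_pos h1, if_neg (fun h' => h' h2)]
      · rw [if_pos ⟨h1, h2⟩, if_pos h1, if_pos h2]
    · rw [if_neg (fun h' => h1 h'.1), if_neg h1]
  have hmemPP : ∀ p ∈ PP, p.Prime := fun p hp => (Nat.mem_primesLE.mp (Finset.mem_filter.mp hp).1).2
  have hf0 : ∀ p ∈ PP, 0 ≤ 1 - 1 / (p : ℝ) := fun p hp => by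
    have h2 : (2 : ℝ) ≤ p := by exact_mod_cast (hmemPP p hp).two_le
    have : 1 / (p : ℝ) ≤ 1 / 2 := one_div_le_one_div_of_le (by norm_num) h2
    linarith
  have hsplit := Finset.prod_filter_mul_prod_filter_not PP (fun p => p ∣ E) (fun p => 1 - 1 / (p : ℝ))
  have hdiv : (Nat.totient E : ℝ) / E ≤ ∏ p ∈ PP with p ∣ E, (1 - 1 / (p : ℝ)) :=
    totient_div_le_prod hE (fun p hp => by
      rw [Finset.mem_filter] at hp
      exact Nat.mem_primeFactors.mpr ⟨hmemPP p hp.1, hp.2, hE⟩)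
  have hφpos : 0 < (Nat.totient E : ℝ) / E := by
    have : 0 < Nat.totient E := Nat.totient_pos.mpr (Nat.pos_of_ne_zero hE)
    have : (0 : ℝ) < E := by exact_mod_cast Nat.pos_of_ne_zero hE
    positivity
  have hPPM : ∏ p ∈ PP, (1 - 1 / (p : ℝ)) ≤ 2 * Real.exp (6 / Real.log 2) / Real.log w :=
    prod_filter_lt_le hw hwM
  have hW0 : 0 ≤ ∏ p ∈ PP, (1 - 1 / (p : ℝ)) := Finset.prod_nonneg hf0
  have hB0 : 0 < ∏ p ∈ PP with p ∣ E, (1 - 1 / (p : ℝ)) := hφpos.trans_le hdiv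
  have ht0 : 0 ≤ (E : ℝ) / Nat.totient E := by positivity
  rw [hcprod]
  have heq : ∏ p ∈ PP with ¬ p ∣ E, (1 - 1 / (p : ℝ)) =
      (∏ p ∈ PP, (1 - 1 / (p : ℝ))) / ∏ p ∈ PP with p ∣ E, (1 - 1 / (p : ℝ)) := by
    rw [eq_div_iff hB0.ne', mul_comm, hsplit]
  rw [heq]
  calc (∏ p ∈ PP, (1 - 1 / (p : ℝ))) / ∏ p ∈ PP with p ∣ E, (1 - 1 / (p : ℝ))
      ≤ (∏ p ∈ PP, (1 - 1 / (p : ℝ))) / ((Nat.totient E : ℝ) / E) :=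
        div_le_div_of_nonneg_left hW0 hφpos hdiv
    _ = (∏ p ∈ PP, (1 - 1 / (p : ℝ))) * ((E : ℝ) / Nat.totient E) := by
        rw [div_div_eq_mul_div, mul_div_assoc]
    _ ≤ _ := mul_le_mul_of_nonneg_right hPPM ht0

/-- `V(z)` for the sequence (`z = M + 1`, sieving ranges `w₁, w₂ ≤ M + 1`, `α₁ ≠ 0`, `α₂Δ ≠ 0`):
`V(z) = ∏_{p ≤ M} (1 − ω(p)/p) ≤ (2e^{6/log 2})² (α₁/φ(α₁)) (α₂Δ/φ(α₂Δ)) /(log w₁ log w₂)`. [folklore] -/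
theorem densityProduct_le {K M : ℕ} (h2 : #(sieveClasses w₁ w₂ α₁ β₁ α₂ β₂ 2) ≤ 1)
    (hw₁ : 2 ≤ w₁) (hw₁M : w₁ ≤ (M : ℝ) + 1) (hw₂ : 2 ≤ w₂) (hw₂M : w₂ ≤ (M : ℝ) + 1)
    (hα₁ : α₁ ≠ 0) (hE : α₂ * det α₁ β₁ α₂ β₂ ≠ 0) :
    (seq w₁ w₂ α₁ β₁ α₂ β₂ K).densityProduct (primesProdBelow ((M + 1 : ℕ) : ℝ)) ≤
      (2 * Real.exp (6 / Real.log 2) / Real.log w₁ * ((α₁ : ℝ) / Nat.totient α₁)) *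
        (2 * Real.exp (6 / Real.log 2) / Real.log w₂ *
          (((α₂ * det α₁ β₁ α₂ β₂ : ℕ) : ℝ) / Nat.totient (α₂ * det α₁ β₁ α₂ β₂))) := by
  rw [SieveSequence.densityProduct, primeFactors_primesProdBelow, Nat.ceil_natCast]
  change ∏ p ∈ Nat.primesLE M, (1 - density w₁ w₂ α₁ β₁ α₂ β₂ p) ≤ _
  calc ∏ p ∈ Nat.primesLE M, (1 - density w₁ w₂ α₁ β₁ α₂ β₂ p)
      ≤ ∏ p ∈ Nat.primesLE M, (weight w₁ α₁ p * weight w₂ (α₂ * det α₁ β₁ α₂ β₂) p) := by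
        refine Finset.prod_le_prod (fun p hp => ?_) (fun p hp => ?_)
        · rw [density_prime (Nat.mem_primesLE.mp hp).2]
          exact one_sub_card_div_nonneg (Nat.mem_primesLE.mp hp).2 h2
        · rw [density_prime (Nat.mem_primesLE.mp hp).2]
          exact one_sub_card_div_le (Nat.mem_primesLE.mp hp).2
    _ = (∏ p ∈ Nat.primesLE M, weight w₁ α₁ p) *
          ∏ p ∈ Nat.primesLE M, weight w₂ (α₂ * det α₁ β₁ α₂ β₂) p := Finset.prod_mul_distrib
    _ ≤ _ := by
        have hl1 : 0 < Real.log w₁ := Real.log_pos (by linarith)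
        refine mul_le_mul (prod_weight_le hw₁ hw₁M hα₁) (prod_weight_le hw₂ hw₂M hE)
          (Finset.prod_nonneg fun p hp => weight_nonneg (Nat.mem_primesLE.mp hp).2) ?_
        exact mul_nonneg (div_nonneg (by positivity) hl1.le) (by positivity)

/-! ### Survivors and the sifted set -/

/-- The `k ≤ K` counted by the theorem survive the sieve: no prime divides `Φ(k)` (and the sieving
ranges may be lowered). [folklore] -/
theorem card_survivors_le_sifted (hα₁ : 1 ≤ α₁) (hα₂ : 1 ≤ α₂) {K N : ℕ}
    (hN : (α₁ * K + β₁) * (α₂ * K + β₂) ≤ N) {w₁' w₂' : ℝ} (hw₁ : w₁' ≤ w₁) (hw₂ : w₂' ≤ w₂) (Pz : ℕ) :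
    (#{k ∈ Icc 1 K | (∀ p ∈ (α₁ * k + β₁).primeFactors, w₁ ≤ (p : ℝ)) ∧
        (∀ p ∈ (α₂ * k + β₂).primeFactors, w₂ ≤ (p : ℝ) ∨ p ∣ α₂ * det α₁ β₁ α₂ β₂)} : ℝ) ≤
      (seq w₁' w₂' α₁ β₁ α₂ β₂ K).sifted N Pz := by
  rw [seq_sifted hα₁ hα₂ hN]
  refine Nat.cast_le.mpr (Finset.card_le_card fun k hk => ?_)
  rw [Finset.mem_filter, Finset.mem_Icc] at hk ⊢
  obtain ⟨hkK, hc1, hc2⟩ := hk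
  refine ⟨hkK, ?_⟩
  -- no prime divides `Φ(k)`, so it is coprime to `Pz`
  rw [Nat.coprime_iff_gcd_eq_one]
  by_contra hg
  obtain ⟨q, hq, hqd⟩ := Nat.exists_prime_and_dvd hg
  have hq1 : q ∣ encode w₁' w₂' α₁ β₁ α₂ β₂ k := hqd.trans (Nat.gcd_dvd_left _ _)
  have h₁ := linear_ne_zero (β := β₁) hα₁ hkK.1
  have h₂ := linear_ne_zero (β := β₂) hα₂ hkK.1
  rcases (prime_dvd_encode_iff hq h₁ h₂).mp hq1 with ⟨⟨hqw, -⟩, hqdvd⟩ | ⟨⟨hqw, hqE⟩, hqdvd⟩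
  · have := hc1 q (Nat.mem_primeFactors.mpr ⟨hq, hqdvd, h₁⟩)
    linarith
  · rcases hc2 q (Nat.mem_primeFactors.mpr ⟨hq, hqdvd, h₂⟩) with h | h
    · linarith
    · exact hqE h


/-! ### The degenerate case -/

/-- In the degenerate case (`α₁`, `α₂Δ` odd, `w₁, w₂ > 2`) no `k ≥ 1` survives: if `ℓ₁(k)` is odd then
`ℓ₂(k)` is even (`Δ` odd forces `β₁ ≢ β₂ (mod 2)`). [folklore] -/
theorem not_survivor_of_degenerate (hα₁ : 1 ≤ α₁) (hα₂ : 1 ≤ α₂) (h2α₁ : ¬ 2 ∣ α₁)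
    (h2E : ¬ 2 ∣ α₂ * det α₁ β₁ α₂ β₂) (hw₁ : (2 : ℝ) < w₁) (hw₂ : (2 : ℝ) < w₂) {k : ℕ} (hk : 1 ≤ k) :
    ¬ ((∀ p ∈ (α₁ * k + β₁).primeFactors, w₁ ≤ (p : ℝ)) ∧
        (∀ p ∈ (α₂ * k + β₂).primeFactors, w₂ ≤ (p : ℝ) ∨ p ∣ α₂ * det α₁ β₁ α₂ β₂)) := by
  rintro ⟨hc1, hc2⟩
  have h₁ := linear_ne_zero (β := β₁) hα₁ hk
  have h₂ := linear_ne_zero (β := β₂) hα₂ hk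
  rw [Nat.prime_two.dvd_mul, not_or] at h2E
  obtain ⟨h2α₂, h2det⟩ := h2E
  have hoα₁ : Odd α₁ := Nat.odd_iff.mpr (Nat.two_dvd_ne_zero.mp h2α₁)
  have hoα₂ : Odd α₂ := Nat.odd_iff.mpr (Nat.two_dvd_ne_zero.mp h2α₂)
  have hodet : Odd (det α₁ β₁ α₂ β₂) := Nat.odd_iff.mpr (Nat.two_dvd_ne_zero.mp h2det)
  -- `Δ` odd: `β₂` odd iff `β₁` even
  have hββ : Odd β₂ ↔ Even β₁ := by
    rw [det, Int.natAbs_odd, Int.odd_sub, Int.odd_mul, Int.even_mul] at hodet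
    simp only [Int.odd_coe_nat, Int.even_coe_nat] at hodet
    have hα₂e : ¬ Even α₂ := Nat.not_even_iff_odd.mpr hoα₂
    tauto
  -- `ℓ₁(k)` must be odd
  have hℓ₁ : Odd (α₁ * k + β₁) := by
    by_contra hev
    rw [Nat.not_odd_iff_even] at hev
    have h2 : 2 ∈ (α₁ * k + β₁).primeFactors :=
      Nat.mem_primeFactors.mpr ⟨Nat.prime_two, hev.two_dvd, h₁⟩
    have := hc1 2 h2
    push_cast at this
    linarith
  -- hence `ℓ₂(k)` is even
  have hℓ₂ : Even (α₂ * k + β₂) := by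
    rw [Nat.odd_add, Nat.odd_mul] at hℓ₁
    rw [Nat.even_add, Nat.even_mul]
    have hα₁e : ¬ Even α₁ := Nat.not_even_iff_odd.mpr hoα₁
    have hα₂e : ¬ Even α₂ := Nat.not_even_iff_odd.mpr hoα₂
    rcases Nat.even_or_odd k with hke | hko
    · have hko : ¬ Odd k := Nat.not_odd_iff_even.mpr hke
      have hβ₁ : ¬ Even β₁ := fun h => hko ((hℓ₁.mpr h).2)
      have hβ₂ : Even β₂ := by
        rcases Nat.even_or_odd β₂ with h | h
        · exact h
        · exact absurd (hββ.mp h) hβ₁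
      exact iff_of_true (Or.inr hke) hβ₂
    · have hβ₁ : Even β₁ := hℓ₁.mp ⟨hoα₁, hko⟩
      have hβ₂ : ¬ Even β₂ := Nat.not_even_iff_odd.mpr (hββ.mpr hβ₁)
      have hke : ¬ Even k := Nat.not_even_iff_odd.mpr hko
      exact iff_of_false (by tauto) hβ₂
  have h2 : 2 ∈ (α₂ * k + β₂).primeFactors := Nat.mem_primeFactors.mpr ⟨Nat.prime_two, hℓ₂.two_dvd, h₂⟩
  rcases hc2 2 h2 with h | h
  · push_cast at h; linarith
  · exact absurd h (by rw [Nat.prime_two.dvd_mul, not_or]; exact ⟨h2α₂, h2det⟩)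

/-! ### The theorem -/

set_option maxHeartbeats 800000 in
/-- **The two-dimensional sieve bound for a pair of linear forms, uniform in the coefficients.**
There is an absolute `C > 0` such that for all `K`, all `α₁, α₂ ≥ 1`, `β₁, β₂` with
`Δ = |α₁β₂ − α₂β₁| ≠ 0`, and all `2 ≤ w₁, w₂ ≤ K`,
`#{1 ≤ k ≤ K : p ∣ α₁k+β₁ ⇒ p ≥ w₁; p ∣ α₂k+β₂ ⇒ (p ≥ w₂ or p ∣ α₂Δ)}`
`≤ C (α₁/φ(α₁)) (α₂Δ/φ(α₂Δ)) K/(log w₁ log w₂)`.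
For `α₁ = 1, β₁ = 0, α₂ = 1, β₂ = h` this is Matomäki–Merikoski's Lemma 3.1(i) with `m₁ = m₂ = 0`
(`(h/φ(h)) X/(log w₁ log w₂)`). [cite: MatomakiMerikoski2023, Lemma 3.1] -/
theorem card_sifted_le : ∃ C : ℝ, 0 < C ∧ ∀ (K α₁ β₁ α₂ β₂ : ℕ), 1 ≤ α₁ → 1 ≤ α₂ →
    det α₁ β₁ α₂ β₂ ≠ 0 → ∀ w₁ w₂ : ℝ, 2 ≤ w₁ → w₁ ≤ K → 2 ≤ w₂ → w₂ ≤ K →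
      (#{k ∈ Icc 1 K | (∀ p ∈ (α₁ * k + β₁).primeFactors, w₁ ≤ (p : ℝ)) ∧
          (∀ p ∈ (α₂ * k + β₂).primeFactors, w₂ ≤ (p : ℝ) ∨ p ∣ α₂ * det α₁ β₁ α₂ β₂)} : ℝ) ≤
        C * ((α₁ : ℝ) / Nat.totient α₁) *
          (((α₂ * det α₁ β₁ α₂ β₂ : ℕ) : ℝ) / Nat.totient (α₂ * det α₁ β₁ α₂ β₂)) *
          (K : ℝ) / (Real.log w₁ * Real.log w₂) := by
  obtain ⟨Kd, hKd⟩ : ∃ Kd : ℝ, Kd = 2 * Real.exp (17 + 12 / Real.log 2) := ⟨_, rfl⟩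
  obtain ⟨E₆, hE₆⟩ : ∃ E₆ : ℝ, E₆ = 2 * Real.exp (6 / Real.log 2) := ⟨_, rfl⟩
  have hl2 : (0.6931471803 : ℝ) < Real.log 2 := Real.log_two_gt_d9
  have hl2' : Real.log 2 < 0.6931471808 := Real.log_two_lt_d9
  have hlog2 : 0 < Real.log 2 := by linarith
  have hKd0 : 0 ≤ Kd := by rw [hKd]; positivity
  have hE₆0 : 0 ≤ E₆ := by rw [hE₆]; positivity
  set C : ℝ := 152 ^ 2 + (1 + 2 * Kd ^ 10) * (76 ^ 2 * E₆ ^ 2) + 2 ^ 42 with hC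
  have hC152 : (152 : ℝ) ^ 2 ≤ C := by
    have : 0 ≤ (1 + 2 * Kd ^ 10) * (76 ^ 2 * E₆ ^ 2) := by positivity
    rw [hC]; linarith
  refine ⟨C, by positivity, ?_⟩
  intro K α₁ β₁ α₂ β₂ hα₁ hα₂ hdet w₁ w₂ hw₁ hw₁K hw₂ hw₂K
  -- abbreviations
  set T := {k ∈ Icc 1 K | (∀ p ∈ (α₁ * k + β₁).primeFactors, w₁ ≤ (p : ℝ)) ∧
      (∀ p ∈ (α₂ * k + β₂).primeFactors, w₂ ≤ (p : ℝ) ∨ p ∣ α₂ * det α₁ β₁ α₂ β₂)} with hT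
  obtain ⟨f₁, hf₁⟩ : ∃ f₁ : ℝ, f₁ = (α₁ : ℝ) / Nat.totient α₁ := ⟨_, rfl⟩
  obtain ⟨f₂, hf₂⟩ : ∃ f₂ : ℝ, f₂ = (((α₂ * det α₁ β₁ α₂ β₂ : ℕ) : ℝ) /
      Nat.totient (α₂ * det α₁ β₁ α₂ β₂)) := ⟨_, rfl⟩
  rw [← hf₁, ← hf₂]
  have hE0 : α₂ * det α₁ β₁ α₂ β₂ ≠ 0 := Nat.mul_ne_zero (by omega) hdet
  have hf₁1 : 1 ≤ f₁ := by
    have hφ : (0 : ℝ) < Nat.totient α₁ := by exact_mod_cast Nat.totient_pos.mpr (by omega)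
    rw [hf₁, le_div_iff₀ hφ, one_mul]; exact_mod_cast Nat.totient_le α₁
  have hf₂1 : 1 ≤ f₂ := by
    have hφ : (0 : ℝ) < Nat.totient (α₂ * det α₁ β₁ α₂ β₂) := by
      exact_mod_cast Nat.totient_pos.mpr (Nat.pos_of_ne_zero hE0)
    rw [hf₂, le_div_iff₀ hφ, one_mul]; exact_mod_cast Nat.totient_le _
  have hK2 : (2 : ℝ) ≤ K := hw₁.trans hw₁K
  have hK0 : (0 : ℝ) < K := by linarith
  have hlogw₁ : 0 < Real.log w₁ := Real.log_pos (by linarith)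
  have hlogw₂ : 0 < Real.log w₂ := Real.log_pos (by linarith)
  have hlogK : 0 < Real.log K := Real.log_pos (by linarith)
  have hlw₁K : Real.log w₁ ≤ Real.log K := Real.log_le_log (by linarith) hw₁K
  have hlw₂K : Real.log w₂ ≤ Real.log K := Real.log_le_log (by linarith) hw₂K
  have hLL : 0 < Real.log w₁ * Real.log w₂ := mul_pos hlogw₁ hlogw₂
  have hTK : (#T : ℝ) ≤ K := by
    have := (Finset.card_filter_le (Icc 1 K) _ : #T ≤ #(Icc 1 K))
    rw [Nat.card_Icc, Nat.add_sub_cancel] at this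
    exact_mod_cast this
  -- the target, divided through
  rw [le_div_iff₀ hLL]
  have hgoal : ∀ B : ℝ, (#T : ℝ) * (Real.log w₁ * Real.log w₂) ≤ B * K → B ≤ C →
      (#T : ℝ) * (Real.log w₁ * Real.log w₂) ≤ C * f₁ * f₂ * K := by
    intro B h1 h2
    have h3 : B * K ≤ C * K := mul_le_mul_of_nonneg_right h2 hK0.le
    have h4 : C * K ≤ C * f₁ * f₂ * K := by
      have : C * K * 1 ≤ C * K * (f₁ * f₂) :=
        mul_le_mul_of_nonneg_left (one_le_mul_of_one_le_of_one_le hf₁1 hf₂1) (by positivity)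
      linarith
    linarith
  -- Case 1: `K` small
  by_cases hKs : Real.log K < 152 * Real.log 2
  · refine hgoal (152 ^ 2) ?_ hC152
    have h1 : Real.log w₁ * Real.log w₂ ≤ 152 ^ 2 := by
      have : Real.log K ≤ 152 := by linarith only [hKs, hl2']
      calc Real.log w₁ * Real.log w₂ ≤ Real.log K * Real.log K :=
            mul_le_mul hlw₁K hlw₂K hlogw₂.le hlogK.le
        _ ≤ 152 * 152 := mul_le_mul this this hlogK.le (by norm_num)
        _ = 152 ^ 2 := by norm_num
    calc (#T : ℝ) * (Real.log w₁ * Real.log w₂) ≤ K * 152 ^ 2 := mul_le_mul hTK h1 hLL.le hK0.le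
      _ = 152 ^ 2 * K := by ring
  push Not at hKs
  -- Parameters `Y = K^{1/76}`, `m = ⌊Y⌋`, `z = m + 1`, `D = z^19`, and capped sieving ranges
  obtain ⟨Y, hY⟩ : ∃ Y : ℝ, Y = (K : ℝ) ^ ((1 : ℝ) / 76) := ⟨_, rfl⟩
  have hY0 : 0 < Y := by rw [hY]; positivity
  have hlogY : Real.log Y = Real.log K / 76 := by rw [hY, Real.log_rpow hK0]; ring
  have hY4 : 4 ≤ Y := by
    have : Real.log 4 ≤ Real.log Y := by
      rw [hlogY, show (4 : ℝ) = 2 ^ 2 by norm_num, Real.log_pow]; push_cast; linarith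
    exact (Real.log_le_log_iff (by norm_num) hY0).mp this
  have hYK : Y ≤ Real.sqrt K := by
    rw [hY, Real.sqrt_eq_rpow]
    exact Real.rpow_le_rpow_of_exponent_le (by linarith) (by norm_num)
  obtain ⟨m, hm⟩ : ∃ m : ℕ, m = ⌊Y⌋₊ := ⟨_, rfl⟩
  have hmY : (m : ℝ) ≤ Y := by rw [hm]; exact Nat.floor_le hY0.le
  have hYm : Y < m + 1 := by rw [hm]; exact Nat.lt_floor_add_one Y
  have hm4 : 4 ≤ m := by rw [hm]; exact Nat.le_floor (by exact_mod_cast hY4)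
  obtain ⟨z, hz⟩ : ∃ z : ℝ, z = ((m + 1 : ℕ) : ℝ) := ⟨_, rfl⟩
  have hzm : z = (m : ℝ) + 1 := by rw [hz]; push_cast; ring
  have hz5 : (5 : ℝ) ≤ z := by rw [hzm]; exact_mod_cast (by omega : 5 ≤ m + 1)
  have hz2 : (2 : ℝ) ≤ z := by linarith
  have hz1 : 1 < z := by linarith
  have hlogz : 0 < Real.log z := Real.log_pos hz1
  have hzY : z ≤ 2 * Y := by rw [hzm]; linarith
  have hYz : Y < z := by rw [hzm]; exact hYm
  have hD1 : (1 : ℝ) < z ^ 19 := one_lt_pow₀ hz1 (by norm_num)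
  have hlogD : Real.log (z ^ 19) = 19 * Real.log z := by rw [Real.log_pow]; push_cast; ring
  have hzD : (9 * (2 : ℝ) + 1) * Real.log z ≤ Real.log (z ^ 19) := by rw [hlogD]; norm_num
  set w₁' : ℝ := min w₁ z with hw₁'
  set w₂' : ℝ := min w₂ z with hw₂'
  have hw₁'2 : 2 ≤ w₁' := le_min hw₁ hz2
  have hw₂'2 : 2 ≤ w₂' := le_min hw₂ hz2
  have hw₁'z : w₁' ≤ (m : ℝ) + 1 := by rw [← hzm]; exact min_le_right _ _
  have hw₂'z : w₂' ≤ (m : ℝ) + 1 := by rw [← hzm]; exact min_le_right _ _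
  have hw₁'le : w₁' ≤ w₁ := min_le_left _ _
  have hw₂'le : w₂' ≤ w₂ := min_le_left _ _
  -- `log w_i' ≥ log w_i / 76`
  have hlogw' : ∀ {w : ℝ}, 2 ≤ w → w ≤ K → Real.log w / 76 ≤ Real.log (min w z) := by
    intro w hw hwK
    have hlw : 0 ≤ Real.log w := Real.log_nonneg (by linarith)
    rcases le_total w z with h | h
    · rw [min_eq_left h]; linarith
    · rw [min_eq_right h]
      have h1 : Real.log Y ≤ Real.log z := Real.log_le_log hY0 hYz.le
      have h2 : Real.log w ≤ Real.log K := Real.log_le_log (by linarith) hwK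
      rw [hlogY] at h1
      linarith
  have hlw₁' := hlogw' hw₁ hw₁K
  have hlw₂' := hlogw' hw₂ hw₂K
  rw [← hw₁'] at hlw₁'
  rw [← hw₂'] at hlw₂'
  have hlogw₁' : 0 < Real.log w₁' := lt_of_lt_of_le (by positivity) hlw₁'
  have hlogw₂' : 0 < Real.log w₂' := lt_of_lt_of_le (by positivity) hlw₂'
  -- Case 2: the degenerate case
  by_cases hnd : (2 : ℝ) < w₁' ∧ ¬ 2 ∣ α₁ ∧ (2 : ℝ) < w₂' ∧ ¬ 2 ∣ α₂ * det α₁ β₁ α₂ β₂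
  · have hT0 : T = ∅ := by
      rw [hT, Finset.filter_eq_empty_iff]
      intro k hk
      rw [Finset.mem_Icc] at hk
      exact not_survivor_of_degenerate hα₁ hα₂ hnd.2.1 hnd.2.2.2 (hnd.1.trans_le hw₁'le)
        (hnd.2.2.1.trans_le hw₂'le) hk.1
    refine hgoal 0 ?_ (by positivity)
    rw [hT0]; simp
  have h2 := card_sieveClasses_two_le (β₁ := β₁) (β₂ := β₂) hnd
  -- Case 3: the sieve
  obtain ⟨N, hN⟩ : ∃ N : ℕ, N = (α₁ * K + β₁) * (α₂ * K + β₂) := ⟨_, rfl⟩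
  have hNle : (α₁ * K + β₁) * (α₂ * K + β₂) ≤ N := by rw [hN]
  have hdim := hasSieveDimension_density h2
  rw [← hKd] at hdim
  have hsize : 0 ≤ (seq w₁' w₂' α₁ β₁ α₂ β₂ K).size (N : ℝ) := by rw [seq_size]; exact Nat.cast_nonneg _
  have hsieve := SieveSequence.sifted_le_of_dvd_primesProdBelow (A := seq w₁' w₂' α₁ β₁ α₂ β₂ K) hdim
    (by norm_num : (0 : ℝ) < 2) hz2 hD1 hzD hsize (dvd_refl (primesProdBelow z))
  have hexp : Real.exp ((9 * (2 : ℝ) + 1) - Real.log (z ^ 19) / Real.log z) = 1 := by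
    rw [hlogD, mul_div_assoc, div_self hlogz.ne', mul_one]; norm_num
  rw [hexp, mul_one, seq_size] at hsieve
  -- the remainder sum: `≤ D · D ≤ 2^38 √K`
  have hrem : ∑ d ∈ (primesProdBelow z).divisors.filter (fun d : ℕ => (d : ℝ) ≤ z ^ 19),
      |(seq w₁' w₂' α₁ β₁ α₂ β₂ K).remainder d (N : ℝ)| ≤ z ^ 19 * z ^ 19 := by
    have h1 : ∀ d ∈ (primesProdBelow z).divisors.filter (fun d : ℕ => (d : ℝ) ≤ z ^ 19),
        |(seq w₁' w₂' α₁ β₁ α₂ β₂ K).remainder d (N : ℝ)| ≤ z ^ 19 := by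
      intro d hd
      rw [Finset.mem_filter, Nat.mem_divisors] at hd
      have hsq : Squarefree d := (squarefree_primesProdBelow z).squarefree_of_dvd hd.1.1
      exact (abs_remainder_le hα₁ hα₂ hNle hsq).trans hd.2
    have h2' : (#((primesProdBelow z).divisors.filter (fun d : ℕ => (d : ℝ) ≤ z ^ 19)) : ℝ) ≤
        z ^ 19 := by
      have hsub : (primesProdBelow z).divisors.filter (fun d : ℕ => (d : ℝ) ≤ z ^ 19) ⊆
          Icc 1 ⌊z ^ 19⌋₊ := by
        intro d hd
        rw [Finset.mem_filter, Nat.mem_divisors] at hd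
        rw [Finset.mem_Icc]
        exact ⟨Nat.pos_of_dvd_of_pos hd.1.1 (Nat.pos_of_ne_zero hd.1.2), Nat.le_floor hd.2⟩
      calc (#((primesProdBelow z).divisors.filter (fun d : ℕ => (d : ℝ) ≤ z ^ 19)) : ℝ)
          ≤ #(Icc 1 ⌊z ^ 19⌋₊) := by exact_mod_cast Finset.card_le_card hsub
        _ = ((⌊z ^ 19⌋₊ : ℕ) : ℝ) := by rw [Nat.card_Icc, Nat.add_sub_cancel]
        _ ≤ z ^ 19 := Nat.floor_le (by positivity)
    calc ∑ d ∈ (primesProdBelow z).divisors.filter (fun d : ℕ => (d : ℝ) ≤ z ^ 19),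
          |(seq w₁' w₂' α₁ β₁ α₂ β₂ K).remainder d (N : ℝ)|
        ≤ #((primesProdBelow z).divisors.filter (fun d : ℕ => (d : ℝ) ≤ z ^ 19)) • z ^ 19 :=
          Finset.sum_le_card_nsmul _ _ _ h1
      _ = (#((primesProdBelow z).divisors.filter (fun d : ℕ => (d : ℝ) ≤ z ^ 19)) : ℝ) * z ^ 19 := by
          rw [nsmul_eq_mul]
      _ ≤ z ^ 19 * z ^ 19 := mul_le_mul_of_nonneg_right h2' (by positivity)
  have hDD : z ^ 19 * z ^ 19 ≤ 2 ^ 38 * Real.sqrt K := by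
    have h2' : z ^ 38 ≤ (2 * Y) ^ 38 := pow_le_pow_left₀ (by linarith) hzY 38
    have h3 : Y ^ 38 = Real.sqrt K := by
      rw [hY, ← Real.rpow_natCast, ← Real.rpow_mul hK0.le, Real.sqrt_eq_rpow]; norm_num
    calc z ^ 19 * z ^ 19 = z ^ 38 := by ring
      _ ≤ (2 * Y) ^ 38 := h2'
      _ = 2 ^ 38 * Y ^ 38 := by ring
      _ = 2 ^ 38 * Real.sqrt K := by rw [h3]
  have hsqrtK : Real.sqrt K * (Real.log w₁ * Real.log w₂) ≤ 16 * K := by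
    have hls := log_sq_le_sqrt (show (1 : ℝ) ≤ K by linarith)
    have hKK : Real.sqrt K * Real.sqrt K = K := Real.mul_self_sqrt hK0.le
    calc Real.sqrt K * (Real.log w₁ * Real.log w₂) ≤ Real.sqrt K * Real.log K ^ 2 := by
          refine mul_le_mul_of_nonneg_left ?_ (Real.sqrt_nonneg _)
          rw [sq]; exact mul_le_mul hlw₁K hlw₂K hlogw₂.le hlogK.le
      _ ≤ Real.sqrt K * (16 * Real.sqrt K) := mul_le_mul_of_nonneg_left hls (Real.sqrt_nonneg _)
      _ = 16 * K := by rw [mul_left_comm, hKK]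
  -- `V(z)`
  have hV := densityProduct_le (K := K) (β₁ := β₁) (β₂ := β₂) h2 hw₁'2 hw₁'z hw₂'2 hw₂'z
    (by omega : α₁ ≠ 0) hE0
  rw [← hz, ← hf₁, ← hf₂] at hV
  have hV' : (seq w₁' w₂' α₁ β₁ α₂ β₂ K).densityProduct (primesProdBelow z) *
      (Real.log w₁ * Real.log w₂) ≤ 76 ^ 2 * E₆ ^ 2 * f₁ * f₂ := by
    have hA : 2 * Real.exp (6 / Real.log 2) / Real.log w₁' * Real.log w₁ ≤ 76 * E₆ := by
      rw [hE₆, div_mul_eq_mul_div, div_le_iff₀ hlogw₁']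
      have : Real.log w₁ ≤ 76 * Real.log w₁' := by linarith
      calc 2 * Real.exp (6 / Real.log 2) * Real.log w₁
          ≤ 2 * Real.exp (6 / Real.log 2) * (76 * Real.log w₁') :=
            mul_le_mul_of_nonneg_left this (by positivity)
        _ = 76 * (2 * Real.exp (6 / Real.log 2)) * Real.log w₁' := by ring
    have hB : 2 * Real.exp (6 / Real.log 2) / Real.log w₂' * Real.log w₂ ≤ 76 * E₆ := by
      rw [hE₆, div_mul_eq_mul_div, div_le_iff₀ hlogw₂']
      have : Real.log w₂ ≤ 76 * Real.log w₂' := by linarith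
      calc 2 * Real.exp (6 / Real.log 2) * Real.log w₂
          ≤ 2 * Real.exp (6 / Real.log 2) * (76 * Real.log w₂') :=
            mul_le_mul_of_nonneg_left this (by positivity)
        _ = 76 * (2 * Real.exp (6 / Real.log 2)) * Real.log w₂' := by ring
    have hA0 : 0 ≤ 2 * Real.exp (6 / Real.log 2) / Real.log w₁' * Real.log w₁ := by positivity
    have hB0 : 0 ≤ 2 * Real.exp (6 / Real.log 2) / Real.log w₂' * Real.log w₂ := by positivity
    calc (seq w₁' w₂' α₁ β₁ α₂ β₂ K).densityProduct (primesProdBelow z) * (Real.log w₁ * Real.log w₂)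
        ≤ (2 * Real.exp (6 / Real.log 2) / Real.log w₁' * f₁ *
            (2 * Real.exp (6 / Real.log 2) / Real.log w₂' * f₂)) * (Real.log w₁ * Real.log w₂) :=
          mul_le_mul_of_nonneg_right hV hLL.le
      _ = (2 * Real.exp (6 / Real.log 2) / Real.log w₁' * Real.log w₁) *
            (2 * Real.exp (6 / Real.log 2) / Real.log w₂' * Real.log w₂) * (f₁ * f₂) := by ring
      _ ≤ (76 * E₆) * (76 * E₆) * (f₁ * f₂) := by
          refine mul_le_mul_of_nonneg_right (mul_le_mul hA hB hB0 (by positivity)) (by positivity)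
      _ = 76 ^ 2 * E₆ ^ 2 * f₁ * f₂ := by ring
  -- assembly
  have hcount := card_survivors_le_sifted (w₁ := w₁) (w₂ := w₂) hα₁ hα₂ hNle hw₁'le hw₂'le
    (primesProdBelow z)
  rw [← hT] at hcount
  have hK10 : 0 ≤ 1 + 2 * Kd ^ 10 := by positivity
  have hmain : (#T : ℝ) * (Real.log w₁ * Real.log w₂) ≤
      ((1 + 2 * Kd ^ 10) * (76 ^ 2 * E₆ ^ 2) * (f₁ * f₂) + 2 ^ 42) * K := by
    have h1 : (#T : ℝ) ≤ (1 + 2 * Kd ^ 10) * ((K : ℝ) * (seq w₁' w₂' α₁ β₁ α₂ β₂ K).densityProduct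
        (primesProdBelow z)) + 2 ^ 38 * Real.sqrt K :=
      hcount.trans (hsieve.trans (add_le_add le_rfl (hrem.trans hDD)))
    have h2' : (1 + 2 * Kd ^ 10) * ((K : ℝ) * (seq w₁' w₂' α₁ β₁ α₂ β₂ K).densityProduct
        (primesProdBelow z)) * (Real.log w₁ * Real.log w₂) ≤
        (1 + 2 * Kd ^ 10) * (76 ^ 2 * E₆ ^ 2) * (f₁ * f₂) * K := by
      calc (1 + 2 * Kd ^ 10) * ((K : ℝ) * (seq w₁' w₂' α₁ β₁ α₂ β₂ K).densityProduct
            (primesProdBelow z)) * (Real.log w₁ * Real.log w₂)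
          = (1 + 2 * Kd ^ 10) * K * ((seq w₁' w₂' α₁ β₁ α₂ β₂ K).densityProduct (primesProdBelow z) *
              (Real.log w₁ * Real.log w₂)) := by ring
        _ ≤ (1 + 2 * Kd ^ 10) * K * (76 ^ 2 * E₆ ^ 2 * f₁ * f₂) :=
            mul_le_mul_of_nonneg_left hV' (by positivity)
        _ = (1 + 2 * Kd ^ 10) * (76 ^ 2 * E₆ ^ 2) * (f₁ * f₂) * K := by ring
    have h3 : 2 ^ 38 * Real.sqrt K * (Real.log w₁ * Real.log w₂) ≤ 2 ^ 42 * (K : ℝ) := by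
      calc 2 ^ 38 * Real.sqrt K * (Real.log w₁ * Real.log w₂)
          = 2 ^ 38 * (Real.sqrt K * (Real.log w₁ * Real.log w₂)) := by ring
        _ ≤ 2 ^ 38 * (16 * (K : ℝ)) := mul_le_mul_of_nonneg_left hsqrtK (by norm_num)
        _ = 2 ^ 42 * (K : ℝ) := by ring
    calc (#T : ℝ) * (Real.log w₁ * Real.log w₂)
        ≤ ((1 + 2 * Kd ^ 10) * ((K : ℝ) * (seq w₁' w₂' α₁ β₁ α₂ β₂ K).densityProduct
            (primesProdBelow z)) + 2 ^ 38 * Real.sqrt K) * (Real.log w₁ * Real.log w₂) :=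
          mul_le_mul_of_nonneg_right h1 hLL.le
      _ ≤ (1 + 2 * Kd ^ 10) * (76 ^ 2 * E₆ ^ 2) * (f₁ * f₂) * K + 2 ^ 42 * K := by
          rw [add_mul]; exact add_le_add h2' h3
      _ = ((1 + 2 * Kd ^ 10) * (76 ^ 2 * E₆ ^ 2) * (f₁ * f₂) + 2 ^ 42) * K := by ring
  -- final numerics: `B(f₁f₂) ≤ C f₁ f₂`
  have hff : 1 ≤ f₁ * f₂ := one_le_mul_of_one_le_of_one_le hf₁1 hf₂1
  calc (#T : ℝ) * (Real.log w₁ * Real.log w₂)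
      ≤ ((1 + 2 * Kd ^ 10) * (76 ^ 2 * E₆ ^ 2) * (f₁ * f₂) + 2 ^ 42) * K := hmain
    _ ≤ (C * (f₁ * f₂)) * K := by
        refine mul_le_mul_of_nonneg_right ?_ hK0.le
        rw [hC]
        have h1 : (2 : ℝ) ^ 42 ≤ 2 ^ 42 * (f₁ * f₂) := le_mul_of_one_le_right (by norm_num) hff
        have h2' : (0 : ℝ) ≤ 152 ^ 2 * (f₁ * f₂) := by positivity
        have e : (152 ^ 2 + (1 + 2 * Kd ^ 10) * (76 ^ 2 * E₆ ^ 2) + 2 ^ 42) * (f₁ * f₂) =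
            152 ^ 2 * (f₁ * f₂) + (1 + 2 * Kd ^ 10) * (76 ^ 2 * E₆ ^ 2) * (f₁ * f₂) +
              2 ^ 42 * (f₁ * f₂) := by ring
        rw [e]; linarith only [h1, h2']
    _ = C * f₁ * f₂ * K := by ring


end PairLinearSieve

end Literature.NumberTheory.Sieve
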